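import Summits.FinalStateConjecture.FinalStateConjecture.Theorems.PhotonSphereChannelsChannelsResolveTameDevelopmentsRDockReadyTransfer
import HarnessLib

/-!
# Route PhotonSphereChannels · crux `ChannelsResolveTameDevelopmentsR` (K2R-T2, stmt-FinalStateConjecture-17430) ·
# line `tame-lasalle-dock` · stub R / stub D: the transfer needs only NON-RADIATION of the end, not full silence

The end-level transfer `TameLaSalle.isMinkowski_or_exists_isKerrDoc_of_silentEternalIsKerr` (`…RHullRigidGivenSEK.lean`,
p159494) and the dock-ready transfer `isMinkowski_or_isKerrDoc_of_dockReady` (`…RDockReadyTransfer.lean`, p160011) assume the end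
is SILENT (`EndDatum.IsSilent` = two-sided non-radiating far chart ∧ non-expanding shear-free horizon ∧ red-shifted-or-cold), but
their proofs consume only the first conjunct: SEK's hypotheses are about the far chart. This file records the sharper forms —
`isMinkowski_or_exists_isKerrDoc_of_nonRadiating` and `isMinkowski_or_isKerrDoc_of_dockReadyNR` (registered sub-goal of
stmt-FinalStateConjecture-17430) — with `E.IsNonRadiating` in place of `E.IsSilent`, both for the element and for its
representative. Consequence for the skeleton (Reshape 1c of lead c8): stub D `stub_dockReadyHull` may ask of the representative
`(𝓢', E')` only `IsTameClass E' Λ' r₀' ∧ E'.IsNonRadiating` — no horizon-silence has to be transported to the representative,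
which removes the only clause of D that referred to the representative's horizon.

References: O'Neill 1983, Ch. 3, pp. 90–91 [ONeill1983]; Dafermos–Luk 2017, Conjecture 1 [DafermosLuk2017];
Alexakis–Ionescu–Klainerman 2010, Thm. 1.1 [AlexakisIonescuKlainerman2009].
-/

noncomputable section

-- the operator-norm instance on `E4 →L[ℝ] E4 →L[ℝ] ℝ` needs one more level of pending
-- instance problems than the default (as in `PhotonSphereChannelsTameHullDefs.lean`)
set_option maxSynthPendingDepth 3
-- every `Summit.FinalStateConjecture.FinalStateConjecture.…` name repeats the summit = sub-problem segment (D-0017 layout)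
set_option linter.dupNamespace false

open Set Filter Function TopologicalSpace Manifold Bundle
open scoped Topology Manifold ContDiff ENNReal NNReal

namespace Summit.FinalStateConjecture.FinalStateConjecture.Theorems.TameLaSalle

open Literature.Geometry.Lorentzian
open Summit.FinalStateConjecture.FinalStateConjecture.Theorems.TameHull
open Summit.FinalStateConjecture.FinalStateConjecture.Theorems.DarkFuture

/-- **The END-level transfer under NON-RADIATION only** (same statement and proof as
`isMinkowski_or_exists_isKerrDoc_of_silentEternalIsKerr` with `E.IsSilent` weakened to `E.IsNonRadiating`: SEK sees only the far
chart). [cite: DafermosLuk2017, Conjecture 1] [cite: AlexakisIonescuKlainerman2009, Thm 1.1] -/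
theorem isMinkowski_or_exists_isKerrDoc_of_nonRadiating [Kerr.Facts]
    (hSEK : ∀ (M R : ℝ) (C : ℕ → ℝ), 0 ≤ M → max (2 * M) 0 < R → ∀ (𝓢 : Literature.Geometry.Lorentzian.Spacetime.{0} 4) [𝓢.metric.toPseudoRiemannianMetric.HasLeviCivita] [Literature.Geometry.Lorentzian.Kerr.Facts], 𝓢.metric.toPseudoRiemannianMetric.IsRicciFlat → 𝓢.metric.IsGloballyHyperbolic 𝓢.timeOrientation → ∀ (Φ : Literature.Geometry.Lorentzian.Kerr.region (0 : ℝ) R → 𝓢.carrier), IsLocalDiffeomorph 𝓘(ℝ, Literature.Geometry.Lorentzian.E4) (𝓡 4) (⊤ : ℕ∞) Φ → Function.Injective Φ → let B : Literature.Geometry.Lorentzian.ModelBackground := ⟨Literature.Geometry.Lorentzian.Kerr.region 0 R, Literature.Geometry.Lorentzian.Kerr.bilin M 0, fun x ↦ x 0, Literature.Geometry.Lorentzian.Kerr.radius 0⟩; let h : Literature.Geometry.Lorentzian.E4 → Literature.Geometry.Lorentzian.E4 →L[ℝ] Literature.Geometry.Lorentzian.E4 →L[ℝ] ℝ := 𝓢.deviationExtend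 B Φ; let hₜ : Literature.Geometry.Lorentzian.E4 → Literature.Geometry.Lorentzian.E4 →L[ℝ] Literature.Geometry.Lorentzian.E4 →L[ℝ] ℝ := fun y ↦ fderiv ℝ h y (Literature.Geometry.Lorentzian.E4.basisVector 0); (∀ (m : ℕ) (x : Literature.Geometry.Lorentzian.Kerr.region (0 : ℝ) R), ‖iteratedFDeriv ℝ m h x.1‖ * Literature.Geometry.Lorentzian.Kerr.radius 0 x.1 ≤ C m) → (∀ (m : ℕ), ∀ δ > (0 : ℝ), ∃ R' : ℝ, ∀ x : Literature.Geometry.Lorentzian.Kerr.region (0 : ℝ) R, R' < Literature.Geometry.Lorentzian.Kerr.radius 0 x.1 → ‖iteratedFDeriv ℝ m hₜ x.1‖ * Literature.Geometry.Lorentzian.Kerr.radius 0 x.1 ≤ δ) → ((𝓢.blackHoleRegionOfEnd (Set.range Φ)).Nonempty ∨ (𝓢.metric.IsTimelikeGeodesicallyComplete ∧ 𝓢.metric.IsNullGeodesicallyComplete)) → (∃ (M' a : ℝ), 0 < M' ∧ |a| ≤ M' ∧ ∃ Ψ : Literature.Geometry.Lorentzian.Kerr.exterior M' a → 𝓢.carrier,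 Function.Injective Ψ ∧ Set.range Ψ = 𝓢.docOfEnd (Set.range Φ) ∧ Literature.Geometry.Lorentzian.PseudoRiemannianMetric.IsLocalIsometry (Literature.Geometry.Lorentzian.Kerr.smoothMetric M' a (Literature.Geometry.Lorentzian.Kerr.rPlus M' a)).toPseudoRiemannianMetric 𝓢.metric.toPseudoRiemannianMetric Ψ) ∨ (∃ Ψ : Diffeomorph (𝓡 4) 𝓘(ℝ, Literature.Geometry.Lorentzian.E4) 𝓢.carrier Literature.Geometry.Lorentzian.E4 (⊤ : ℕ∞), Literature.Geometry.Lorentzian.PseudoRiemannianMetric.IsIsometry 𝓢.metric.toPseudoRiemannianMetric (Literature.Geometry.Lorentzian.Minkowski.metric.ofLE le_top : Literature.Geometry.Lorentzian.LorentzianMetric 𝓘(ℝ, Literature.Geometry.Lorentzian.E4) (⊤ : ℕ∞) Literature.Geometry.Lorentzian.E4).toPseudoRiemannianMetric Ψ))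
    {𝓢 : Spacetime.{0} 4} [𝓢.metric.HasLeviCivita] (E : EndDatum 𝓢) {Λ : ℕ → ℝ≥0} {r₀ : ℝ}
    (hcls : IsTameClass E Λ r₀) (hnr : E.IsNonRadiating)
    (hGH : 𝓢.metric.IsGloballyHyperbolic 𝓢.timeOrientation)
    (hbh : (𝓢.blackHoleRegionOfEnd (Set.range E.far)).Nonempty ∨
      (𝓢.metric.IsTimelikeGeodesicallyComplete ∧ 𝓢.metric.IsNullGeodesicallyComplete))
    (hsub : ∀ M' a : ℝ, 0 < M' → |a| ≤ M' →
      (∃ Ψ : Kerr.exterior M' a → 𝓢.carrier, Function.Injective Ψ ∧ Set.range Ψ = E.doc ∧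
        PseudoRiemannianMetric.IsLocalIsometry
          (Kerr.smoothMetric M' a (Kerr.rPlus M' a)).toPseudoRiemannianMetric
          𝓢.metric.toPseudoRiemannianMetric Ψ) → |a| < M') :
    IsMinkowski 𝓢 ∨ ∃ M a : ℝ, 0 < M ∧ |a| < M ∧ IsKerrDoc 𝓢 E.doc M a := by
  have htame : E.IsTameEnd (Λ 3) r₀ := hcls.isTameEnd
  have hsmooth : ∀ x : Kerr.region (0 : ℝ) E.R, ContDiffAt ℝ ∞ E.h x.1 :=
    contDiffAt_farDeviation_of_isTameEnd E (Λ 3) r₀ htame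
  -- the far data of `E` in the shape of SEK
  have hM : 0 ≤ E.M := htame.mass_nonneg
  have hR : max (2 * E.M) 0 < E.R := htame.lt_R
  have hRpos : 0 < E.R := lt_of_le_of_lt (le_max_right _ _) hR
  have hvac : 𝓢.metric.toPseudoRiemannianMetric.IsRicciFlat := htame.vacuum
  have hfar_bound : ∀ k : ℕ, ∀ m ≤ k, ∀ x : Kerr.region (0 : ℝ) E.R,
      ‖iteratedFDeriv ℝ m E.h x.1‖ * Kerr.radius 0 x.1 ≤ Λ k := fun k ↦ (hcls.order k).far_bound
  have hbd : ∀ (m : ℕ) (x : Kerr.region (0 : ℝ) E.R),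
      ‖iteratedFDeriv ℝ m E.h x.1‖ * Kerr.radius 0 x.1 ≤ (fun m : ℕ ↦ ((Λ m : ℝ≥0) : ℝ)) m :=
    fun m x ↦ hfar_bound m m le_rfl x
  have hnonrad : ∀ m : ℕ, ∀ δ > (0 : ℝ), ∃ R' : ℝ, ∀ x : Kerr.region (0 : ℝ) E.R,
      R' < Kerr.radius 0 x.1 → ‖iteratedFDeriv ℝ m E.hdot x.1‖ * Kerr.radius 0 x.1 ≤ δ :=
    isNonRadiating_allOrders E Λ hRpos hsmooth hfar_bound hnr
  -- SEK: the d.o.c. is a Kerr exterior up to orientation, or the spacetime is Minkowski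
  have hdich := hSEK E.M E.R (fun m : ℕ ↦ ((Λ m : ℝ≥0) : ℝ)) hM hR 𝓢 hvac hGH E.far
    htame.far_isLocalDiffeomorph htame.far_injective hbd hnonrad hbh
  rcases hdich with ⟨M', a, hM', ha, Ψ, hinj, hrange, hiso⟩ | ⟨Ψ, hΨ⟩
  · -- Kerr branch: sub-extremal by (G5), future-oriented by the orientation fix, exact by G4
    have ha' : |a| < M' := hsub M' a hM' ha ⟨Ψ, hinj, hrange, hiso⟩
    obtain ⟨Ψ', hinj', hrange', hiso', hfut'⟩ :=
      orientationFix_of_subextremal E.doc M' a hM' ha' ⟨Ψ, hinj, hrange, hiso⟩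
    exact Or.inr ⟨M', a, hM', ha', isKerrDoc_of_isLocalIsometry E.doc M' a Ψ' hinj' hrange' hiso' hfut'⟩
  · -- Minkowski branch
    exact Or.inl (isMinkowski_of_isIsometry Ψ hΨ)

/-- **The transfer through a dock-ready representative under NON-RADIATION only** (registered sub-goal
`isMinkowski_or_isKerrDoc_of_dockReadyNR` of stmt-FinalStateConjecture-17430; the statement of
`isMinkowski_or_isKerrDoc_of_dockReady` with `IsSilent` weakened to `IsNonRadiating` for the element and for the representative).
[cite: DafermosLuk2017, Conjecture 1] -/
theorem isMinkowski_or_isKerrDoc_of_dockReadyNR : ∀ [Kerr.Facts], (∀ (M R : ℝ) (C : ℕ → ℝ), 0 ≤ M → max (2 * M) 0 < R → ∀ (𝓢 : Spacetime.{0} 4) [𝓢.metric.toPseudoRiemannianMetric.HasLeviCivita] [Kerr.Facts], 𝓢.metric.toPseudoRiemannianMetric.IsRicciFlat → 𝓢.metric.IsGloballyHyperbolic 𝓢.timeOrientation → ∀ (Φ : Kerr.region (0 : ℝ) R → 𝓢.carrier), IsLocalDiffeomorph 𝓘(ℝ, E4) (𝓡 4) (⊤ : ℕ∞) Φ → Function.Injective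 Φ → let B : ModelBackground := ⟨Kerr.region 0 R, Kerr.bilin M 0, fun x ↦ x 0, Kerr.radius 0⟩; let h : E4 → E4 →L[ℝ] E4 →L[ℝ] ℝ := 𝓢.deviationExtend B Φ; let hₜ : E4 → E4 →L[ℝ] E4 →L[ℝ] ℝ := fun y ↦ fderiv ℝ h y (E4.basisVector 0); (∀ (m : ℕ) (x : Kerr.region (0 : ℝ) R), ‖iteratedFDeriv ℝ m h x.1‖ * Kerr.radius 0 x.1 ≤ C m) → (∀ (m : ℕ), ∀ δ > (0 : ℝ), ∃ R' : ℝ, ∀ x : Kerr.region (0 : ℝ) R, R' < Kerr.radius 0 x.1 → ‖iteratedFDeriv ℝ m hₜ x.1‖ * Kerr.radius 0 x.1 ≤ δ) → ((𝓢.blackHoleRegionOfEnd (Set.range Φ)).Nonempty ∨ (𝓢.metric.IsTimelikeGeodesicallyComplete ∧ 𝓢.metric.IsNullGeodesicallyComplete)) → (∃ (M' a : ℝ), 0 < M' ∧ |a| ≤ M' ∧ ∃ Ψ : Kerr.exterior M' a → 𝓢.carrier, Function.Injective Ψ ∧ Set.range Ψ = 𝓢.docOfEnd (Set.range Φ) ∧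 PseudoRiemannianMetric.IsLocalIsometry (Kerr.smoothMetric M' a (Kerr.rPlus M' a)).toPseudoRiemannianMetric 𝓢.metric.toPseudoRiemannianMetric Ψ) ∨ (∃ Ψ : Diffeomorph (𝓡 4) 𝓘(ℝ, E4) 𝓢.carrier E4 (⊤ : ℕ∞), PseudoRiemannianMetric.IsIsometry 𝓢.metric.toPseudoRiemannianMetric (Minkowski.metric.ofLE le_top : LorentzianMetric 𝓘(ℝ, E4) (⊤ : ℕ∞) E4).toPseudoRiemannianMetric Ψ)) → ∀ {𝓢 : Spacetime.{0} 4} [𝓢.metric.HasLeviCivita] (E : EndDatum 𝓢) {Λ : ℕ → ℝ≥0} {r₀ : ℝ}, IsTameClass E Λ r₀ → E.IsNonRadiating → ((𝓢.metric.IsGloballyHyperbolic 𝓢.timeOrientation ∧ 𝓢.metric.IsTimelikeGeodesicallyComplete ∧ 𝓢.metric.IsNullGeodesicallyComplete) ∨ (∃ (𝓢' : Spacetime.{0} 4) (E' : EndDatum 𝓢') (Λ' : ℕ → ℝ≥0) (r₀' : ℝ) (j : 𝓢'.carrier → 𝓢.carrier), IsTameClass E' Λ' r₀' ∧ E'.IsNonRadiating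 ∧ (∀ [𝓢'.metric.HasLeviCivita], 𝓢'.metric.IsGloballyHyperbolic 𝓢'.timeOrientation ∧ ((𝓢'.blackHoleRegionOfEnd (Set.range E'.far)).Nonempty ∨ (𝓢'.metric.IsTimelikeGeodesicallyComplete ∧ 𝓢'.metric.IsNullGeodesicallyComplete))) ∧ Function.Injective j ∧ PseudoRiemannianMetric.IsLocalIsometry 𝓢'.metric.toPseudoRiemannianMetric 𝓢.metric.toPseudoRiemannianMetric j ∧ (∀ (x : 𝓢'.carrier) (v : TangentSpace (𝓡 4) x), 𝓢'.timeOrientation.IsFutureDirected v → 𝓢.timeOrientation.IsFutureDirected (mfderiv (𝓡 4) (𝓡 4) j x v)) ∧ j '' E'.doc = E.doc ∧ (IsMinkowski 𝓢' → IsMinkowski 𝓢))) → (∀ M' a : ℝ, 0 < M' → |a| ≤ M' → (∃ Ψ : Kerr.exterior M' a → 𝓢.carrier, Function.Injective Ψ ∧ Set.range Ψ = E.doc ∧ PseudoRiemannianMetric.IsLocalIsometry (Kerr.smoothMetric M' a (Kerr.rPlus M' a)).toPseudoRiemannianMetric 𝓢.metric.toPseudoRiemannianMetric Ψ) → |a|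 < M') → (IsMinkowski 𝓢 ∨ ∃ M a : ℝ, 0 < M ∧ |a| < M ∧ IsKerrDoc 𝓢 E.doc M a) := by
  intro _ hSEK 𝓢 _ E Λ r₀ hcls hnr hready hsub
  rcases hready with ⟨hGH, htc, hnc⟩ | ⟨𝓢', E', Λ', r₀', j, hcls', hnr', hGH', hj, hiso, hfut, hdoc, hmink⟩
  · exact isMinkowski_or_exists_isKerrDoc_of_nonRadiating hSEK E hcls hnr hGH (Or.inr ⟨htc, hnc⟩) hsub
  · haveI : 𝓢'.metric.HasLeviCivita := 𝓢'.metric.toPseudoRiemannianMetric.hasLeviCivita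
    obtain ⟨hGH₁, hbh₁⟩ := hGH'
    have hsub' : ∀ M' a : ℝ, 0 < M' → |a| ≤ M' →
        (∃ Ψ : Kerr.exterior M' a → 𝓢'.carrier, Function.Injective Ψ ∧ Set.range Ψ = E'.doc ∧
          PseudoRiemannianMetric.IsLocalIsometry
            (Kerr.smoothMetric M' a (Kerr.rPlus M' a)).toPseudoRiemannianMetric
            𝓢'.metric.toPseudoRiemannianMetric Ψ) → |a| < M' := by
      intro M' a hM' ha h
      refine hsub M' a hM' ha ?_
      rw [← hdoc]
      exact kerrExteriorUpToOrientation_image hj hiso h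
    rcases isMinkowski_or_exists_isKerrDoc_of_nonRadiating hSEK E' hcls' hnr' hGH₁ hbh₁ hsub' with
      hflat | ⟨M, a, hM, ha, hkerr⟩
    · exact Or.inl (hmink hflat)
    · refine Or.inr ⟨M, a, hM, ha, ?_⟩
      rw [← hdoc]
      exact isKerrDoc_image_of_isLocalIsometry j E'.doc M a hj hiso hfut hkerr

/-- The silent forms are corollaries (silence ⊇ non-radiation). [folklore] -/
theorem isMinkowski_or_isKerrDoc_of_dockReady_of_NR (h : ∀ [Kerr.Facts], (∀ (M R : ℝ) (C : ℕ → ℝ), 0 ≤ M → max (2 * M) 0 < R → ∀ (𝓢 : Spacetime.{0} 4) [𝓢.metric.toPseudoRiemannianMetric.HasLeviCivita] [Kerr.Facts], 𝓢.metric.toPseudoRiemannianMetric.IsRicciFlat → 𝓢.metric.IsGloballyHyperbolic 𝓢.timeOrientation → ∀ (Φ : Kerr.region (0 : ℝ) R → 𝓢.carrier), IsLocalDiffeomorph 𝓘(ℝ, E4) (𝓡 4) (⊤ : ℕ∞) Φ → Function.Injective Φ → let B : ModelBackground := ⟨Kerr.region 0 R, Kerr.bilin M 0, fun x ↦ x 0,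 Kerr.radius 0⟩; let h : E4 → E4 →L[ℝ] E4 →L[ℝ] ℝ := 𝓢.deviationExtend B Φ; let hₜ : E4 → E4 →L[ℝ] E4 →L[ℝ] ℝ := fun y ↦ fderiv ℝ h y (E4.basisVector 0); (∀ (m : ℕ) (x : Kerr.region (0 : ℝ) R), ‖iteratedFDeriv ℝ m h x.1‖ * Kerr.radius 0 x.1 ≤ C m) → (∀ (m : ℕ), ∀ δ > (0 : ℝ), ∃ R' : ℝ, ∀ x : Kerr.region (0 : ℝ) R, R' < Kerr.radius 0 x.1 → ‖iteratedFDeriv ℝ m hₜ x.1‖ * Kerr.radius 0 x.1 ≤ δ) → ((𝓢.blackHoleRegionOfEnd (Set.range Φ)).Nonempty ∨ (𝓢.metric.IsTimelikeGeodesicallyComplete ∧ 𝓢.metric.IsNullGeodesicallyComplete)) → (∃ (M' a : ℝ), 0 < M' ∧ |a| ≤ M' ∧ ∃ Ψ : Kerr.exterior M' a → 𝓢.carrier, Function.Injective Ψ ∧ Set.range Ψ = 𝓢.docOfEnd (Set.range Φ) ∧ PseudoRiemannianMetric.IsLocalIsometry (Kerr.smoothMetric M' a (Kerr.rPlus M'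 a)).toPseudoRiemannianMetric 𝓢.metric.toPseudoRiemannianMetric Ψ) ∨ (∃ Ψ : Diffeomorph (𝓡 4) 𝓘(ℝ, E4) 𝓢.carrier E4 (⊤ : ℕ∞), PseudoRiemannianMetric.IsIsometry 𝓢.metric.toPseudoRiemannianMetric (Minkowski.metric.ofLE le_top : LorentzianMetric 𝓘(ℝ, E4) (⊤ : ℕ∞) E4).toPseudoRiemannianMetric Ψ)) → ∀ {𝓢 : Spacetime.{0} 4} [𝓢.metric.HasLeviCivita] (E : EndDatum 𝓢) {Λ : ℕ → ℝ≥0} {r₀ : ℝ}, IsTameClass E Λ r₀ → E.IsNonRadiating → ((𝓢.metric.IsGloballyHyperbolic 𝓢.timeOrientation ∧ 𝓢.metric.IsTimelikeGeodesicallyComplete ∧ 𝓢.metric.IsNullGeodesicallyComplete) ∨ (∃ (𝓢' : Spacetime.{0} 4) (E' : EndDatum 𝓢') (Λ' : ℕ → ℝ≥0) (r₀' : ℝ) (j : 𝓢'.carrier → 𝓢.carrier), IsTameClass E' Λ' r₀' ∧ E'.IsNonRadiating ∧ (∀ [𝓢'.metric.HasLeviCivita], 𝓢'.metric.IsGloballyHyperbolic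 𝓢'.timeOrientation ∧ ((𝓢'.blackHoleRegionOfEnd (Set.range E'.far)).Nonempty ∨ (𝓢'.metric.IsTimelikeGeodesicallyComplete ∧ 𝓢'.metric.IsNullGeodesicallyComplete))) ∧ Function.Injective j ∧ PseudoRiemannianMetric.IsLocalIsometry 𝓢'.metric.toPseudoRiemannianMetric 𝓢.metric.toPseudoRiemannianMetric j ∧ (∀ (x : 𝓢'.carrier) (v : TangentSpace (𝓡 4) x), 𝓢'.timeOrientation.IsFutureDirected v → 𝓢.timeOrientation.IsFutureDirected (mfderiv (𝓡 4) (𝓡 4) j x v)) ∧ j '' E'.doc = E.doc ∧ (IsMinkowski 𝓢' → IsMinkowski 𝓢))) → (∀ M' a : ℝ, 0 < M' → |a| ≤ M' → (∃ Ψ : Kerr.exterior M' a → 𝓢.carrier, Function.Injective Ψ ∧ Set.range Ψ = E.doc ∧ PseudoRiemannianMetric.IsLocalIsometry (Kerr.smoothMetric M' a (Kerr.rPlus M' a)).toPseudoRiemannianMetric 𝓢.metric.toPseudoRiemannianMetric Ψ) → |a| < M') → (IsMinkowski 𝓢 ∨ ∃ M a : ℝ, 0 < M ∧ |a| < M ∧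 IsKerrDoc 𝓢 E.doc M a)) : ∀ [Kerr.Facts], (∀ (M R : ℝ) (C : ℕ → ℝ), 0 ≤ M → max (2 * M) 0 < R → ∀ (𝓢 : Spacetime.{0} 4) [𝓢.metric.toPseudoRiemannianMetric.HasLeviCivita] [Kerr.Facts], 𝓢.metric.toPseudoRiemannianMetric.IsRicciFlat → 𝓢.metric.IsGloballyHyperbolic 𝓢.timeOrientation → ∀ (Φ : Kerr.region (0 : ℝ) R → 𝓢.carrier), IsLocalDiffeomorph 𝓘(ℝ, E4) (𝓡 4) (⊤ : ℕ∞) Φ → Function.Injective Φ → let B : ModelBackground := ⟨Kerr.region 0 R, Kerr.bilin M 0, fun x ↦ x 0, Kerr.radius 0⟩; let h : E4 → E4 →L[ℝ] E4 →L[ℝ] ℝ := 𝓢.deviationExtend B Φ; let hₜ : E4 → E4 →L[ℝ] E4 →L[ℝ] ℝ := fun y ↦ fderiv ℝ h y (E4.basisVector 0); (∀ (m : ℕ) (x : Kerr.region (0 : ℝ) R), ‖iteratedFDeriv ℝ m h x.1‖ * Kerr.radius 0 x.1 ≤ C m) → (∀ (m : ℕ), ∀ δ > (0 : ℝ), ∃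 R' : ℝ, ∀ x : Kerr.region (0 : ℝ) R, R' < Kerr.radius 0 x.1 → ‖iteratedFDeriv ℝ m hₜ x.1‖ * Kerr.radius 0 x.1 ≤ δ) → ((𝓢.blackHoleRegionOfEnd (Set.range Φ)).Nonempty ∨ (𝓢.metric.IsTimelikeGeodesicallyComplete ∧ 𝓢.metric.IsNullGeodesicallyComplete)) → (∃ (M' a : ℝ), 0 < M' ∧ |a| ≤ M' ∧ ∃ Ψ : Kerr.exterior M' a → 𝓢.carrier, Function.Injective Ψ ∧ Set.range Ψ = 𝓢.docOfEnd (Set.range Φ) ∧ PseudoRiemannianMetric.IsLocalIsometry (Kerr.smoothMetric M' a (Kerr.rPlus M' a)).toPseudoRiemannianMetric 𝓢.metric.toPseudoRiemannianMetric Ψ) ∨ (∃ Ψ : Diffeomorph (𝓡 4) 𝓘(ℝ, E4) 𝓢.carrier E4 (⊤ : ℕ∞), PseudoRiemannianMetric.IsIsometry 𝓢.metric.toPseudoRiemannianMetric (Minkowski.metric.ofLE le_top : LorentzianMetric 𝓘(ℝ, E4) (⊤ : ℕ∞) E4).toPseudoRiemannianMetric Ψ)) → ∀ {𝓢 : Spacetime.{0}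 4} [𝓢.metric.HasLeviCivita] (E : EndDatum 𝓢) {Λ : ℕ → ℝ≥0} {r₀ : ℝ}, IsTameClass E Λ r₀ → E.IsSilent → ((𝓢.metric.IsGloballyHyperbolic 𝓢.timeOrientation ∧ 𝓢.metric.IsTimelikeGeodesicallyComplete ∧ 𝓢.metric.IsNullGeodesicallyComplete) ∨ (∃ (𝓢' : Spacetime.{0} 4) (E' : EndDatum 𝓢') (Λ' : ℕ → ℝ≥0) (r₀' : ℝ) (j : 𝓢'.carrier → 𝓢.carrier), IsTameClass E' Λ' r₀' ∧ E'.IsSilent ∧ (∀ [𝓢'.metric.HasLeviCivita], 𝓢'.metric.IsGloballyHyperbolic 𝓢'.timeOrientation ∧ ((𝓢'.blackHoleRegionOfEnd (Set.range E'.far)).Nonempty ∨ (𝓢'.metric.IsTimelikeGeodesicallyComplete ∧ 𝓢'.metric.IsNullGeodesicallyComplete))) ∧ Function.Injective j ∧ PseudoRiemannianMetric.IsLocalIsometry 𝓢'.metric.toPseudoRiemannianMetric 𝓢.metric.toPseudoRiemannianMetric j ∧ (∀ (x : 𝓢'.carrier) (v : TangentSpace (𝓡 4) x), 𝓢'.timeOrientation.IsFutureDirected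 v → 𝓢.timeOrientation.IsFutureDirected (mfderiv (𝓡 4) (𝓡 4) j x v)) ∧ j '' E'.doc = E.doc ∧ (IsMinkowski 𝓢' → IsMinkowski 𝓢))) → (∀ M' a : ℝ, 0 < M' → |a| ≤ M' → (∃ Ψ : Kerr.exterior M' a → 𝓢.carrier, Function.Injective Ψ ∧ Set.range Ψ = E.doc ∧ PseudoRiemannianMetric.IsLocalIsometry (Kerr.smoothMetric M' a (Kerr.rPlus M' a)).toPseudoRiemannianMetric 𝓢.metric.toPseudoRiemannianMetric Ψ) → |a| < M') → (IsMinkowski 𝓢 ∨ ∃ M a : ℝ, 0 < M ∧ |a| < M ∧ IsKerrDoc 𝓢 E.doc M a) := by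
  intro _ hSEK 𝓢 _ E Λ r₀ hcls hsil hready hsub
  refine h hSEK E hcls hsil.1 ?_ hsub
  rcases hready with hB | ⟨𝓢', E', Λ', r₀', j, hcls', hsil', hrest⟩
  · exact Or.inl hB
  · exact Or.inr ⟨𝓢', E', Λ', r₀', j, hcls', hsil'.1, hrest⟩

end Summit.FinalStateConjecture.FinalStateConjecture.Theorems.TameLaSalle

end
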